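import Literature.Combinatorics.LorentzianPolynomials.OneAddThetaXPderiv
import Literature.Combinatorics.LorentzianPolynomials.StrictlyLorentzianQuadratic
import HarnessLib

/-!
# `(1 + θ w_i ∂_j)` on strictly Lorentzian polynomials: claim (I) of Brändén–Huh's proof of Lemma 2.12

Layer `Literature/Combinatorics/LorentzianPolynomials`, namespace `Literature.Combinatorics.LorentzianPolynomials`;
lane `lit-hodgefound` (Track 2 foundations library), seat p16, generation 29 (row g29-#8). Brändén–Huh prove the
Nuij-type homotopy Lemma 2.12 (`T_n(θ, f) ∈ L̊^d_n` for `f ∈ L^d_n ∩ P^d_n`) through three claims about the univariate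
restrictions `∂^α f(x e_n - v)`; claim (I) — "If `∂^α f` has two distinct real zeros, then `∂^α (1 + θ w_i ∂_n) f` has
two distinct zeros" — is proved here in the Hessian language of Lemma 2.5 (`StrictlyLorentzianQuadratic`): the strict
reverse Cauchy–Schwarz inequality at `(e_j, v)` passes from `𝓗(∂^α f)` to `𝓗(∂^α (1 + θ w_i ∂_j) f)` for
`f ∈ L^d_n ∩ P^d_n`. With the second description of `L̊^d_n` this gives the corollary, implicit in the source ("Using
Proposition 2.7, we can deduce the preceding statement from the following claims"), that **`(1 + θ w_i ∂_j)` maps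
`L̊^d_n` to `L̊^d_n`** for `θ ≥ 0` — the strictly Lorentzian companion of Proposition 2.7 (`OneAddThetaXPderiv`).

## Source (verbatim) — P. Brändén, J. Huh, *Lorentzian polynomials* [BrandenHuh2019] (held `paper:arxiv-1902.03719`)

§2.3 (pp. 15–16): "Let `θ` be a nonnegative real parameter. We define a linear operator `T_n(θ, -)` by
`T_n(θ, f) = (∏_{i=1}^{n-1} (1 + θ w_i ∂_n)^d) f`. By Proposition 2.7, if `f ∈ L^d_n`, then `T_n(θ, f) ∈ L^d_n`. In
addition, if `f ∈ P^d_n`, then `T_n(θ, f) ∈ P^d_n`. […] **Lemma 2.12.** If `f ∈ L^d_n ∩ P^d_n`, then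
`T_n(θ, f) ∈ L̊^d_n` for every positive real number `θ`. *Proof.* Let `e_i` be the `i`-th standard unit vector in
`ℝ^n`, and let `v` be any vector in `ℝ^n` not parallel to `e_n`. From here on, in this proof, all polynomials are
restricted to the line `x e_n - v` and considered as univariate polynomials in `x`. Let `α` be an arbitrary element of
`Δ^{d-2}_n`. By Lemma 2.5, it is enough to show that the quadratic polynomial `∂^α T_n(θ, f)` has two distinct real
zeros. Using Proposition 2.7, we can deduce the preceding statement from the following claims: (I) If `∂^α f` has two
distinct real zeros, then `∂^α (1 + θ w_i ∂_n) f` has two distinct zeros. […] We first prove (I). Suppose `∂^α f` has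
two distinct real zeros, and set `g = (1 + θ w_i ∂_n) f`. Note that
`∂^α g = ∂^α f + θ α_i ∂^{α-e_i+e_n} f + θ w_i ∂^{α+e_n} f`. Let `c` be the unique zero of `∂^{α+e_n} f`. Since `c`
strictly interlaces two distinct zeros of `∂^α f`, we have `∂^α f|_{x=c} < 0`. Similarly, since `∂^{α-e_i+e_n} f` has
only real zeros and `∂^{α+e_n} f ≺ ∂^{α-e_i+e_n} f`, we have `∂^{α-e_i+e_n} f|_{x=c} ≤ 0`. Thus `∂^α g|_{x=c} < 0`,
and hence `∂^α g` has two distinct real zeros. This completes the proof of (I)."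

## The proof in Hessian language

On the line `x e_j - v` the quadratic `∂^α f` is `½ B_P(x e_j - v, x e_j - v)` with `B_P` the form of
`P = 𝓗(∂^α f)`, and the linear form `∂^{α+e_j} f` is `B_P(e_j, ·)` (`= B_Q(e_i, ·)` for `Q = 𝓗(∂^{α-e_i+e_j} f)`: both
are the vector `u = (c_{α+e_j+e_k}(f))_k`). The "unique zero `c`" is the critical point `c = B_P(e_j, v)/B_P(e_j, e_j)`,
`w = c e_j - v` is `B_P`-orthogonal to `e_j`; "two distinct real zeros" is `B_P(w, w) < 0` (the strict reverse
Cauchy–Schwarz inequality of Lemma 2.5); "`∂^{α+e_j} f ≺ ∂^{α-e_i+e_j} f` … `≤ 0`" is `B_Q(w, w) ≤ 0` for `w ⊥ e_i`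
(`LorentzianReverseSchwarz.self_nonpos_of_orthogonal_of_self_pos`, `Q` having at most one positive eigenvalue and
`Q_{ii} > 0`); and since `𝓗(∂^α g) = P + θ α_i Q + θ (e_i uᵀ + u e_iᵀ)` (`OneAddThetaXPderiv.borderUpdate`), the value
`B_G(w, w) = B_P(w, w) + θ α_i B_Q(w, w) + 2 θ w_i (uᵀw)` has `uᵀw = B_P(e_j, w) = 0` — "`∂^α g|_{x=c} < 0`".

## What is here

* §1 `(1 + θ w_i ∂_j)` preserves `P^d_n` (`coeff_oneAddXPderiv_pos`); the Hessian of `∂^α (1 + θ w_i ∂_j) f`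
  (`hessian_iterPderiv_oneAddXPderiv`) and the common column `u = 𝓗(∂^α f) e_j = 𝓗(∂^{α-e_i+e_j} f) e_i`.
* §2 **claim (I)** (`mul_lt_sq_hessian_iterPderiv_oneAddXPderiv`) for `f ∈ L^d_n ∩ P^d_n`, `θ ≥ 0`, any `i, j`.
* §3 **`(1 + θ w_i ∂_j)` maps `L̊^d_n` to `L̊^d_n`** (`oneAddXPderiv_mem_strictlyLorentzian`) and its iterate over a list
  of operators (`foldr_oneAddXPderiv_mem_strictlyLorentzian`).

Theorems only; no `sorry`, no named fact (net debt 0).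

## References

* [BrandenHuh2019] P. Brändén, J. Huh, *Lorentzian polynomials*, Ann. of Math. (2) 192 (2020) 821–891, arXiv:1902.03719 —
  §2.3 Lemma 2.12 and its proof, claim (I) (pp. 15–16); §2.1 Lemma 2.5; §2.2 Prop. 2.7.
-/

noncomputable section

open MvPolynomial Finsupp Finset
open Literature.LinearAlgebra.QuadraticForm

namespace Literature.Combinatorics.LorentzianPolynomials

variable {σ : Type*} [Fintype σ] [DecidableEq σ]

/-! ## §1 `P^d_n` and the Hessians of `∂^α (1 + θ w_i ∂_j) f` -/

section Hessians

omit [DecidableEq σ] in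
/-- "if `f ∈ P^d_n`, then `T_n(θ, f) ∈ P^d_n`": for `θ ≥ 0`, `(1 + θ w_i ∂_j)` keeps all degree-`d` coefficients of a
degree-`d` form positive (`c_β(g) = c_β(f) + θ β_i c_{β-e_i+e_j}(f) ≥ c_β(f) > 0`). [cite: BrandenHuh2019, §2.3 (p. 15,
"In addition, if `f ∈ P^d_n`, then `T_n(θ, f) ∈ P^d_n`")] -/
theorem coeff_oneAddXPderiv_pos {θ : ℝ} (hθ : 0 ≤ θ) (i j : σ) {f : MvPolynomial σ ℝ} {d : ℕ} (hf : f.IsHomogeneous d)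
    (hpos : ∀ β : σ →₀ ℕ, β.degree = d → 0 < coeff β f) (β : σ →₀ ℕ) (hβ : β.degree = d) :
    0 < coeff β (oneAddXPderiv θ i j f) := by
  classical
  have hnn := coeff_nonneg_of_forall_coeff_pos hf hpos
  rw [← normCoeff_pos_iff, normCoeff_oneAddXPderiv]
  exact add_pos_of_pos_of_nonneg (normCoeff_pos_iff.2 (hpos β hβ))
    (mul_nonneg hθ (mul_nonneg (Nat.cast_nonneg _) (normCoeff_nonneg_iff.2 (hnn _))))

omit [DecidableEq σ] in
/-- For `f ∈ P^{m+2}_n` and `α ∈ Δ^m_n`, every entry `c_{α+e_a+e_b}(f)` of `𝓗(∂^α f)` is positive.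
[cite: BrandenHuh2019, §2.1 Lemma 2.5 (proof: "all the entries of `𝓗_f` are positive"); §2.3 proof of Lemma 2.12] -/
theorem hessian_iterPderiv_apply_pos {m : ℕ} {f : MvPolynomial σ ℝ}
    (hpos : ∀ β : σ →₀ ℕ, β.degree = m + 2 → 0 < coeff β f) {α : σ →₀ ℕ} (hα : α.degree = m) (a b : σ) :
    0 < hessian (iterPderiv α f) a b := by
  rw [hessian_iterPderiv, normCoeff_pos_iff]
  exact hpos _ (by rw [map_add, map_add, degree_single, degree_single, hα])

/-- **`𝓗(∂^α f) e_j = u`**, `u_k = c_{α+e_j+e_k}(f)` — the gradient of the linear form `∂^{α+e_j} f`.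
[cite: BrandenHuh2019, §2.3 proof of Lemma 2.12 ("Let `c` be the unique zero of `∂^{α+e_n} f`")] -/
theorem hessian_iterPderiv_mulVec_single (α : σ →₀ ℕ) (f : MvPolynomial σ ℝ) (j : σ) :
    (hessian (iterPderiv α f)).mulVec (Pi.single j 1) =
      fun k ↦ normCoeff (α + Finsupp.single j 1 + Finsupp.single k 1) f := by
  ext a
  rw [Matrix.mulVec_single_one, Matrix.col_apply, hessian_iterPderiv,
    add_right_comm α (Finsupp.single a 1) (Finsupp.single j 1)]

/-- **`𝓗(∂^{α-e_i+e_j} f) e_i = u`** as well (when `α_i > 0`): `∂^{α+e_j} f = ∂_i ∂^{α-e_i+e_j} f` — "`∂^{α+e_n} f ≺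
∂^{α-e_i+e_n} f`". [cite: BrandenHuh2019, §2.3 proof of Lemma 2.12 (claim (I))] -/
theorem hessian_iterPderiv_sub_add_mulVec_single {α : σ →₀ ℕ} {i : σ} (hαi : α i ≠ 0) (f : MvPolynomial σ ℝ) (j : σ) :
    (hessian (iterPderiv (α - Finsupp.single i 1 + Finsupp.single j 1) f)).mulVec (Pi.single i 1) =
      fun k ↦ normCoeff (α + Finsupp.single j 1 + Finsupp.single k 1) f := by
  ext a
  rw [Matrix.mulVec_single_one, Matrix.col_apply, hessian_iterPderiv,
    add_right_comm (α - Finsupp.single i 1 + Finsupp.single j 1) (Finsupp.single a 1) (Finsupp.single i 1),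
    add_right_comm (α - Finsupp.single i 1) (Finsupp.single j 1) (Finsupp.single i 1),
    Finsupp.sub_add_single_one_cancel hαi]

/-- **The Hessian of `∂^α (1 + θ w_i ∂_j) f`**: `𝓗(∂^α g) = 𝓗(∂^α f) + θ α_i 𝓗(∂^{α-e_i+e_j} f) + θ (e_i uᵀ + u e_iᵀ)` with
`u = (c_{α+e_j+e_k}(f))_k` — "`∂^α g = ∂^α f + θ α_i ∂^{α-e_i+e_n} f + θ w_i ∂^{α+e_n} f`".
[cite: BrandenHuh2019, §2.3 proof of Lemma 2.12 (claim (I)); §2.2 proof of Prop. 2.7] -/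
theorem hessian_iterPderiv_oneAddXPderiv (θ : ℝ) (i j : σ) (f : MvPolynomial σ ℝ) (α : σ →₀ ℕ) :
    hessian (iterPderiv α (oneAddXPderiv θ i j f)) =
      borderUpdate (hessian (iterPderiv α f) +
        (θ * α i) • hessian (iterPderiv (α - Finsupp.single i 1 + Finsupp.single j 1) f)) θ i
        (fun k ↦ normCoeff (α + Finsupp.single j 1 + Finsupp.single k 1) f) := by
  ext a b
  rw [hessian_iterPderiv, borderUpdate_apply, Matrix.add_apply, Matrix.smul_apply, smul_eq_mul, hessian_iterPderiv,
    hessian_iterPderiv, normCoeff_oneAddXPderiv_add_single_add_single]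

/-- `uᵀw` for `u = Hb`: `Σ_a (Hb)_a w_a = wᵀ H b`. [cite: BrandenHuh2019, §2.3 proof of Lemma 2.12 (claim (I), the term
`θ w_i ∂^{α+e_n} f` at `x = c`)] -/
theorem sum_mulVec_mul_eq_toBilin' (H : Matrix σ σ ℝ) (b w : σ → ℝ) :
    ∑ a, H.mulVec b a * w a = Matrix.toBilin' H w b := by
  rw [Matrix.toBilin'_apply', dotProduct]
  exact Finset.sum_congr rfl fun a _ ↦ mul_comm _ _

end Hessians

/-! ## §2 Claim (I) -/

section ClaimI

/-- **Brändén–Huh, proof of Lemma 2.12, claim (I), in Hessian form.** Let `f ∈ L^{m+2}_n ∩ P^{m+2}_n`, `θ ≥ 0`,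
`α ∈ Δ^m_n`, and write `B_h` for the form `wᵀ 𝓗(h) w'`. If `∂^α f` "has two distinct real zeros on the line `x e_j - v`"
— `B_{∂^α f}(v, v) B_{∂^α f}(e_j, e_j) < B_{∂^α f}(v, e_j)²` — then so does `∂^α (1 + θ w_i ∂_j) f`. (At the critical
point `w = c e_j - v`, `c = B(e_j, v)/B(e_j, e_j)`: `B_{∂^α f}(w,w) < 0`, `B_{∂^{α-e_i+e_j} f}(w,w) ≤ 0` as `w ⊥ e_i` for
that form, and the border term `2θ w_i · uᵀw` vanishes, so `B_{∂^α g}(w,w) < 0`.)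
[cite: BrandenHuh2019, §2.3 proof of Lemma 2.12, claim (I) (pp. 15–16)] -/
theorem mul_lt_sq_hessian_iterPderiv_oneAddXPderiv {m : ℕ} {f : MvPolynomial σ ℝ} (hL : f ∈ lorentzian σ (m + 2))
    (hP : ∀ β : σ →₀ ℕ, β.degree = m + 2 → 0 < coeff β f) {θ : ℝ} (hθ : 0 ≤ θ) (i j : σ) {α : σ →₀ ℕ}
    (hα : α.degree = m) {v : σ → ℝ}
    (hv : Matrix.toBilin' (hessian (iterPderiv α f)) v v *
        Matrix.toBilin' (hessian (iterPderiv α f)) (Pi.single j 1) (Pi.single j 1) <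
      Matrix.toBilin' (hessian (iterPderiv α f)) v (Pi.single j 1) ^ 2) :
    Matrix.toBilin' (hessian (iterPderiv α (oneAddXPderiv θ i j f))) v v *
        Matrix.toBilin' (hessian (iterPderiv α (oneAddXPderiv θ i j f))) (Pi.single j 1) (Pi.single j 1) <
      Matrix.toBilin' (hessian (iterPderiv α (oneAddXPderiv θ i j f))) v (Pi.single j 1) ^ 2 := by
  classical
  have hsig := (mem_lorentzian_iff_forall_sigPos_hessian.1 hL).2
  -- the two Hessians `P = 𝓗(∂^α f)`, `Q = 𝓗(∂^{α-e_i+e_j} f)`, the border `u`, the basis vector `e = e_j`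
  obtain ⟨P, hPdef⟩ : ∃ P, P = hessian (iterPderiv α f) := ⟨_, rfl⟩
  obtain ⟨Q, hQdef⟩ : ∃ Q, Q = hessian (iterPderiv (α - Finsupp.single i 1 + Finsupp.single j 1) f) := ⟨_, rfl⟩
  obtain ⟨u, hudef⟩ : ∃ u : σ → ℝ, u = fun k ↦ normCoeff (α + Finsupp.single j 1 + Finsupp.single k 1) f := ⟨_, rfl⟩
  obtain ⟨e, hedef⟩ : ∃ e : σ → ℝ, e = Pi.single j 1 := ⟨_, rfl⟩
  rw [← hPdef, ← hedef] at hv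
  have hmat : hessian (iterPderiv α (oneAddXPderiv θ i j f)) = borderUpdate (P + (θ * α i) • Q) θ i u := by
    rw [hessian_iterPderiv_oneAddXPderiv, hPdef, hQdef, hudef]
  have hPu : P.mulVec e = u := by rw [hPdef, hedef, hudef, hessian_iterPderiv_mulVec_single]
  have hPsymm : P.IsSymm := by rw [hPdef]; exact isSymm_hessian _
  have hPee : 0 < Matrix.toBilin' P e e := by
    rw [hedef, Matrix.toBilin'_single, hPdef]; exact hessian_iterPderiv_apply_pos hP hα j j
  -- the critical point `c` and the vector `w = c e - v ⊥ e`
  obtain ⟨c, hcdef⟩ : ∃ c : ℝ, c = Matrix.toBilin' P e v / Matrix.toBilin' P e e := ⟨_, rfl⟩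
  have hPew : Matrix.toBilin' P e (c • e - v) = 0 := by
    rw [hcdef]; exact toBilin'_self_smul_sub_eq_zero P hPee.ne' v
  have huw : ∑ a, u a * (c • e - v) a = 0 := by
    rw [← hPu, sum_mulVec_mul_eq_toBilin', symm_apply (isSymm_toBilin'_of_isSymm hPsymm) _ e, hPew]
  -- `∂^α f|_{x=c} < 0`
  have hPww : Matrix.toBilin' P (c • e - v) (c • e - v) < 0 := by
    rw [hcdef]; exact toBilin'_smul_sub_self_neg_of_mul_lt_sq hPsymm hPee hv
  -- `θ α_i ∂^{α-e_i+e_j} f|_{x=c} ≤ 0`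
  have hQww : θ * α i * Matrix.toBilin' Q (c • e - v) (c • e - v) ≤ 0 := by
    rcases eq_or_ne (α i) 0 with hαi | hαi
    · rw [hαi, Nat.cast_zero, mul_zero, zero_mul]
    · have hdeg : (α - Finsupp.single i 1 + Finsupp.single j 1).degree = m := by
        rw [degree_sub_single_add_single hαi, hα]
      have hQu : Q.mulVec (Pi.single i 1) = u := by
        rw [hQdef, hudef, hessian_iterPderiv_sub_add_mulVec_single hαi]
      have hQsymm : Q.IsSymm := by rw [hQdef]; exact isSymm_hessian _
      have hQii : 0 < Matrix.toBilin' Q (Pi.single i 1) (Pi.single i 1) := by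
        rw [Matrix.toBilin'_single, hQdef]; exact hessian_iterPderiv_apply_pos hP hdeg i i
      have hQwi : Matrix.toBilin' Q (c • e - v) (Pi.single i 1) = 0 := by
        rw [← sum_mulVec_mul_eq_toBilin', hQu, huw]
      have h1 : sigPos (Matrix.toBilin' Q).toQuadraticMap ≤ 1 := by rw [hQdef]; exact hsig _ hdeg
      have hle := self_nonpos_of_orthogonal_of_self_pos (Matrix.toBilin' Q) (isSymm_toBilin'_of_isSymm hQsymm) h1
        hQii hQwi
      exact mul_nonpos_of_nonneg_of_nonpos (mul_nonneg hθ (Nat.cast_nonneg _)) hle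
  -- hence `∂^α g|_{x=c} < 0`
  have hGww : Matrix.toBilin' (hessian (iterPderiv α (oneAddXPderiv θ i j f))) (c • e - v) (c • e - v) < 0 := by
    rw [hmat, toBilin'_borderUpdate, huw]
    simp only [mul_zero, add_zero, map_add, map_smul, LinearMap.add_apply, LinearMap.smul_apply, smul_eq_mul]
    linarith
  -- and `∂^α g` has positive leading coefficient `𝓗(∂^α g)_{jj} = c_{α+2e_j}(g) > 0` on the line
  have hGee : 0 < Matrix.toBilin' (hessian (iterPderiv α (oneAddXPderiv θ i j f))) e e := by
    rw [hedef, Matrix.toBilin'_single]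
    exact hessian_iterPderiv_apply_pos (fun β hβ ↦ coeff_oneAddXPderiv_pos hθ i j
      (isHomogeneous_of_mem_lorentzian hL) hP β hβ) hα j j
  rw [← hedef]
  exact mul_lt_sq_of_toBilin'_smul_sub_self_neg (isSymm_hessian _) hGee hGww

end ClaimI

/-! ## §3 `(1 + θ w_i ∂_j)` preserves `L̊^d_n` -/

section Strictly

/-- **`(1 + θ w_i ∂_j)` maps `L̊^d_n` to `L̊^d_n` for `θ ≥ 0`** — the strictly Lorentzian companion of Proposition 2.7,
by claim (I) of the proof of Lemma 2.12 for every `α ∈ Δ^{d-2}_n` and every line `x e_j - v`, and Lemma 2.5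
((1) ⟹ (2) for `∂^α f`, (3) ⟹ (1) for `∂^α g`, `u = e_j`). [cite: BrandenHuh2019, §2.3 proof of Lemma 2.12 (claim (I)
and "Using Proposition 2.7, we can deduce the preceding statement from the following claims"); §2.1 Lemma 2.5] -/
theorem oneAddXPderiv_mem_strictlyLorentzian :
    ∀ {d : ℕ} {f : MvPolynomial σ ℝ}, f ∈ strictlyLorentzian σ d → ∀ {θ : ℝ}, 0 ≤ θ → ∀ i j : σ,
      oneAddXPderiv θ i j f ∈ strictlyLorentzian σ d
  | 0, _, hf, θ, hθ, i, j =>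
    mem_strictlyLorentzian_zero.2 ⟨isHomogeneous_oneAddXPderiv θ i j (mem_strictlyLorentzian_zero.1 hf).1,
      coeff_oneAddXPderiv_pos hθ i j (mem_strictlyLorentzian_zero.1 hf).1 (mem_strictlyLorentzian_zero.1 hf).2⟩
  | 1, _, hf, θ, hθ, i, j =>
    mem_strictlyLorentzian_one.2 ⟨isHomogeneous_oneAddXPderiv θ i j (mem_strictlyLorentzian_one.1 hf).1,
      coeff_oneAddXPderiv_pos hθ i j (mem_strictlyLorentzian_one.1 hf).1 (mem_strictlyLorentzian_one.1 hf).2⟩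
  | m + 2, f, hf, θ, hθ, i, j => by
    classical
    obtain ⟨⟨hhom, hpos⟩, hα⟩ := mem_strictlyLorentzian_iff_forall_iterPderiv.1 hf
    have hL : f ∈ lorentzian σ (m + 2) := mem_lorentzian_of_mem_strictlyLorentzian hf
    have hhom' : (oneAddXPderiv θ i j f).IsHomogeneous (m + 2) := isHomogeneous_oneAddXPderiv θ i j hhom
    have hpos' : ∀ β : σ →₀ ℕ, β.degree = m + 2 → 0 < coeff β (oneAddXPderiv θ i j f) :=
      coeff_oneAddXPderiv_pos hθ i j hhom hpos
    refine mem_strictlyLorentzian_iff_forall_iterPderiv.2 ⟨⟨hhom', hpos'⟩, fun α hαm ↦ ?_⟩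
    have hq : (iterPderiv α (oneAddXPderiv θ i j f)).IsHomogeneous 2 :=
      IsHomogeneous.iterPderiv α (by rw [hαm, add_comm]; exact hhom')
    have hqpos : ∀ β : σ →₀ ℕ, β.degree = 2 → 0 < coeff β (iterPderiv α (oneAddXPderiv θ i j f)) := fun β hβ ↦ by
      rw [← normCoeff_pos_iff, normCoeff_iterPderiv, normCoeff_pos_iff]
      exact hpos' _ (by rw [map_add, hαm, hβ])
    have hee : 0 < Matrix.toBilin' (hessian (iterPderiv α (oneAddXPderiv θ i j f))) (Pi.single j 1) (Pi.single j 1) := by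
      rw [Matrix.toBilin'_single]; exact hessian_iterPderiv_apply_pos hpos' hαm j j
    have hfee : 0 < Matrix.toBilin' (hessian (iterPderiv α f)) (Pi.single j 1) (Pi.single j 1) := by
      rw [Matrix.toBilin'_single]; exact hessian_iterPderiv_apply_pos hpos hαm j j
    refine mem_strictlyLorentzian_two_of_mul_lt_sq hq hqpos hee fun v hv ↦ ?_
    exact mul_lt_sq_hessian_iterPderiv_oneAddXPderiv hL hpos hθ i j hαm
      (mul_lt_sq_of_mem_strictlyLorentzian_two (hα α hαm) hfee hv)

/-- **Products of operators `(1 + θ w_i ∂_j)`, `θ ≥ 0`, preserve `L̊^d_n`** (as a `foldr` over a list of triples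
`(θ, i, j)`) — e.g. Brändén–Huh's `T_n(θ, -)` maps `L̊^d_n` to itself. [cite: BrandenHuh2019, §2.3 (p. 15, the operator
`T_n`) and proof of Lemma 2.12 (claim (I))] -/
theorem foldr_oneAddXPderiv_mem_strictlyLorentzian {d : ℕ} :
    ∀ (l : List (ℝ × σ × σ)), (∀ p ∈ l, 0 ≤ p.1) → ∀ {f : MvPolynomial σ ℝ}, f ∈ strictlyLorentzian σ d →
      l.foldr (fun p g ↦ oneAddXPderiv p.1 p.2.1 p.2.2 g) f ∈ strictlyLorentzian σ d
  | [], _, _, hf => by simpa using hf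
  | p :: l, hl, f, hf => by
    rw [List.foldr_cons]
    exact oneAddXPderiv_mem_strictlyLorentzian
      (foldr_oneAddXPderiv_mem_strictlyLorentzian l (fun q hq ↦ hl q (List.mem_cons_of_mem p hq)) hf)
      (hl p (by simp)) _ _

end Strictly

end Literature.Combinatorics.LorentzianPolynomials

end
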